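import Summits.HubbardSuperconductivity.HubbardLadder.Su2WeightZeroReduction
import Literature.MathematicalPhysics.QuantumLattice.SpinChargeKinematics
import Summits.HubbardSuperconductivity.HubbardLadder.ClusterCutFlipRule

/-!
# XInvariance — a weighted pair operator with an invariant weight table commutes with the lattice symmetry ([C](b0″), generic part)

HONEST FRAMING: ladder R1–R4 with certified numbers; no claim on H/H₀.  Cell pub-hubbard, lane r2 (g43).  Generic lemma toward the
hypothesis `hX : X * U g = U g * X` of `oct12_pieces`: if the weight table `w` is invariant under a site relabelling `e`
(`w (e i) (e j) = w i j`), then `X_w = Σ_{i,j} w i j • 𝐒_i·𝐒_j` satisfies `reindexOp e X_w = X_w`, hence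
`permOp e * X_w = X_w * permOp e`.  (For the oct12 row: `w` = the SYMMETRIC orbit-weight table of the cut, invariance decided on an integer
table.)  FLIP HALF (spin ½, via the landed flip rule `ClusterCutFlipRule`): the entries `4·⟨σ|X_P|τ⟩ = xint4Entry P σ τ` are invariant
under reversing every spin (`pairEntry4_revCfg`, `xint4Entry_revCfg`), so `F * X_P * F = X_P` and `F * X_P = X_P * F` for the permutation matrix
`F` of any configuration involution that acts as the spin reversal (`toMatrix_mul_pairOp`, with `flipOp` of `Oct12Representation` as the instance);
finally `commute_mul_of_commute` assembles `X * (P * F) = (P * F) * X`.  All [folklore].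
-/

namespace Summit.HubbardSuperconductivity.HubbardLadder.ClusterCut

open Matrix Literature.MathematicalPhysics.QuantumLattice

variable {Λ : Type*} [Fintype Λ] [DecidableEq Λ] {q : ℕ}

/-- The weighted pair operator `X_w = Σ_{i,j} w i j • 𝐒_i·𝐒_j` (spin `n/2`). [folklore] -/
noncomputable def weightedPairOp (n : ℕ) (w : Λ → Λ → ℂ) : Op Λ (n + 1) :=
  ∑ i, ∑ j, w i j • spinDot n i j

/-- **Relabelling invariance**: an `e`-invariant weight table gives an `e`-invariant operator. [folklore] -/
theorem reindexOp_weightedPairOp (e : Λ ≃ Λ) (n : ℕ) (w : Λ → Λ → ℂ) (hw : ∀ i j, w (e i) (e j) = w i j) :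
    reindexOp e (weightedPairOp n w) = weightedPairOp n w := by
  unfold weightedPairOp
  simp only [map_sum, map_smul, reindexOp_spinDot]
  -- Σ_i Σ_j w i j • S(e i)·S(e j)  =  Σ_i Σ_j w (e i) (e j) • S(e i)·S(e j)  =  Σ_{i'} Σ_{j'} w i' j' • S i'·S j'
  calc ∑ i, ∑ j, w i j • spinDot n (e i) (e j)
      = ∑ i, ∑ j, w (e i) (e j) • spinDot n (e i) (e j) := by
        simp only [hw]
    _ = ∑ i, ∑ j, w i j • spinDot n i j := by
        rw [← Fintype.sum_equiv e (fun i => ∑ j, w (e i) (e j) • spinDot n (e i) (e j))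
          (fun i => ∑ j, w i j • spinDot n i j) (fun i => ?_)]
        exact Fintype.sum_equiv e _ _ fun j => rfl

/-- **Commutation with the permutation operator**: `permOp e * X_w = X_w * permOp e` for an `e`-invariant table. [folklore] -/
theorem permOp_mul_weightedPairOp (e : Λ ≃ Λ) (n : ℕ) (w : Λ → Λ → ℂ) (hw : ∀ i j, w (e i) (e j) = w i j) :
    permOp e * weightedPairOp n w = weightedPairOp n w * permOp e := by
  have h := permOp_mul_mul_conjTranspose e (weightedPairOp n w)
  rw [reindexOp_weightedPairOp e n w hw] at h
  -- multiply `P X Pᴴ = X` on the right by `P`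
  have h2 := congrArg (fun A => A * permOp (q := n + 1) e) h
  rwa [Matrix.mul_assoc, conjTranspose_permOp_mul, Matrix.mul_one] at h2

/-! ## Flip half (spin ½): the flip rule's entries are invariant under reversing every spin -/

section Flip

variable {N : ℕ}

/-- Reverse every spin of a spin-½ configuration (`0 ↔ 1` at every site). [folklore] -/
def revCfg (σ : Fin N → Fin 2) : Fin N → Fin 2 := fun z => Fin.rev (σ z)

/-- `revCfg` is an involution. [folklore] -/
theorem revCfg_revCfg (σ : Fin N → Fin 2) : revCfg (revCfg σ) = σ := by
  funext z; simp [revCfg]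

/-- `revCfg` is injective (as an iff). [folklore] -/
theorem revCfg_inj {σ τ : Fin N → Fin 2} : revCfg σ = revCfg τ ↔ σ = τ :=
  ⟨fun h => by rw [← revCfg_revCfg σ, h, revCfg_revCfg], fun h => by rw [h]⟩

/-- Reversing spins commutes with exchanging two sites. [folklore] -/
theorem swapAt_revCfg (σ : Fin N → Fin 2) (i j : Fin N) : swapAt (revCfg σ) i j = revCfg (swapAt σ i j) := by
  funext z
  simp only [swapAt, revCfg]
  split_ifs <;> rfl

/-- **The flip-rule entry is spin-reversal invariant**: `pairEntry4 i j σ̄ τ̄ = pairEntry4 i j σ τ`. [folklore] -/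
theorem pairEntry4_revCfg (i j : Fin N) (σ τ : Fin N → Fin 2) :
    pairEntry4 i j (revCfg σ) (revCfg τ) = pairEntry4 i j σ τ := by
  have h1 : (revCfg σ i = revCfg σ j) ↔ (σ i = σ j) := by simp [revCfg, Fin.rev_inj]
  have h2 : (revCfg τ = swapAt (revCfg σ) i j) ↔ (τ = swapAt σ i j) := by rw [swapAt_revCfg, revCfg_inj]
  simp only [pairEntry4, ne_eq, revCfg_inj, h1, h2]

/-- Hence `xint4Entry P σ̄ τ̄ = xint4Entry P σ τ`. [folklore] -/
theorem xint4Entry_revCfg (P : PairList N) (σ τ : Fin N → Fin 2) :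
    xint4Entry P (revCfg σ) (revCfg τ) = xint4Entry P σ τ := by
  simp only [xint4Entry, pairEntry4_revCfg]

/-- Hence the matrix entries of `X_P` are spin-reversal invariant. [folklore] -/
theorem pairOp_apply_revCfg (P : PairList N) (hP : ∀ p ∈ P, p.1 ≠ p.2.1) (σ τ : Fin N → Fin 2) :
    pairOp P (revCfg σ) (revCfg τ) = pairOp P σ τ := by
  have h := xint4Entry_eq P hP (revCfg σ) (revCfg τ)
  rw [xint4Entry_revCfg, ← xint4Entry_eq P hP σ τ] at h
  exact mul_left_cancel₀ (by norm_num : (4 : ℂ) ≠ 0) h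

end Flip

/-! ## Conjugating by the permutation matrix of a configuration involution -/

section Involution

variable {ι : Type*} [Fintype ι] [DecidableEq ι]

/-- Entries of `F * A * F` for the permutation matrix `F` of an involution `f` of the index type: `(F A F) σ τ = A (f σ) (f τ)`. [folklore] -/
theorem toMatrix_mul_mul_toMatrix_apply (f : Equiv.Perm ι) (hf : ∀ x, f (f x) = x) (A : Matrix ι ι ℂ) (σ τ : ι) :
    ((f.toPEquiv.toMatrix : Matrix ι ι ℂ) * A * (f.toPEquiv.toMatrix : Matrix ι ι ℂ)) σ τ = A (f σ) (f τ) := by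
  have key : ∀ κ, (f κ = τ) ↔ (κ = f τ) := fun κ => ⟨fun h => by rw [← h, hf], fun h => by rw [h, hf]⟩
  simp only [Matrix.mul_apply, PEquiv.toMatrix_apply, Equiv.toPEquiv_apply, Option.mem_def, Option.some.injEq, ite_mul, one_mul,
    zero_mul, mul_ite, mul_one, mul_zero, Finset.sum_ite_eq, Finset.mem_univ, if_true, key, Finset.sum_ite_eq']

/-- If the entries of `A` are `f`-invariant then `F * A * F = A`. [folklore] -/
theorem toMatrix_mul_mul_toMatrix_eq (f : Equiv.Perm ι) (hf : ∀ x, f (f x) = x) (A : Matrix ι ι ℂ)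
    (hA : ∀ σ τ, A (f σ) (f τ) = A σ τ) : (f.toPEquiv.toMatrix : Matrix ι ι ℂ) * A * (f.toPEquiv.toMatrix : Matrix ι ι ℂ) = A := by
  ext σ τ
  rw [toMatrix_mul_mul_toMatrix_apply f hf, hA]

/-- … and then `F * A = A * F` (`F² = 1`). [folklore] -/
theorem toMatrix_mul_eq_mul_toMatrix (f : Equiv.Perm ι) (hf : ∀ x, f (f x) = x) (A : Matrix ι ι ℂ)
    (hA : ∀ σ τ, A (f σ) (f τ) = A σ τ) : (f.toPEquiv.toMatrix : Matrix ι ι ℂ) * A = A * (f.toPEquiv.toMatrix : Matrix ι ι ℂ) := by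
  have hFF : (f.toPEquiv.toMatrix : Matrix ι ι ℂ) * f.toPEquiv.toMatrix = 1 := by
    rw [← PEquiv.toMatrix_trans, ← Equiv.toPEquiv_trans]
    have : f.trans f = Equiv.refl ι := by ext x; simp [hf]
    rw [this, Equiv.toPEquiv_refl, PEquiv.toMatrix_refl]
  have h := congrArg (fun B => B * (f.toPEquiv.toMatrix : Matrix ι ι ℂ)) (toMatrix_mul_mul_toMatrix_eq f hf A hA)
  simpa only [Matrix.mul_assoc, hFF, Matrix.mul_one] using h

end Involution

/-- **Flip commutation for a weighted pair operator** (spin ½): if `f` acts on configurations as the spin reversal, its permutation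
matrix commutes with every `X_P` (pairs with distinct sites).  Instance: `f = flipCfgPerm (Fin N) 2`, `F = flipOp (Fin N) 2`. [folklore] -/
theorem toMatrix_mul_pairOp {N : ℕ} (f : Equiv.Perm (Fin N → Fin 2)) (hf : ∀ σ, f σ = revCfg σ) (P : PairList N)
    (hP : ∀ p ∈ P, p.1 ≠ p.2.1) : (f.toPEquiv.toMatrix : Op (Fin N) 2) * pairOp P = pairOp P * (f.toPEquiv.toMatrix : Op (Fin N) 2) := by
  refine toMatrix_mul_eq_mul_toMatrix f (fun σ => by rw [hf, hf, revCfg_revCfg]) (pairOp P) fun σ τ => ?_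
  rw [hf, hf, pairOp_apply_revCfg P hP]

/-- A single exchange operator `𝐒_i·𝐒_j` (`i ≠ j`, spin ½) has spin-reversal invariant entries. [folklore] -/
theorem spinDot_one_apply_revCfg {N : ℕ} {i j : Fin N} (hij : i ≠ j) (σ τ : Fin N → Fin 2) :
    spinDot 1 i j (revCfg σ) (revCfg τ) = spinDot 1 i j σ τ := by
  have h := four_mul_spinDot_apply hij (revCfg σ) (revCfg τ)
  rw [pairEntry4_revCfg, ← four_mul_spinDot_apply hij σ τ] at h
  exact mul_left_cancel₀ (by norm_num : (4 : ℂ) ≠ 0) h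

/-- **Flip commutation for `X_w`** (spin ½, zero diagonal weights): the permutation matrix of the spin reversal commutes with
`X_w = Σ_{i,j} w i j • 𝐒_i·𝐒_j`.  Instance: `f = flipCfgPerm (Fin N) 2`, `F = flipOp (Fin N) 2`. [folklore] -/
theorem toMatrix_mul_weightedPairOp {N : ℕ} (f : Equiv.Perm (Fin N → Fin 2)) (hf : ∀ σ, f σ = revCfg σ) (w : Fin N → Fin N → ℂ)
    (hw0 : ∀ i, w i i = 0) :
    (f.toPEquiv.toMatrix : Op (Fin N) 2) * weightedPairOp 1 w = weightedPairOp 1 w * (f.toPEquiv.toMatrix : Op (Fin N) 2) := by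
  refine toMatrix_mul_eq_mul_toMatrix f (fun σ => by rw [hf, hf, revCfg_revCfg]) (weightedPairOp 1 w) fun σ τ => ?_
  rw [hf, hf]
  simp only [weightedPairOp, Matrix.sum_apply, Matrix.smul_apply, smul_eq_mul]
  refine Finset.sum_congr rfl fun i _ => Finset.sum_congr rfl fun j _ => ?_
  by_cases hij : i = j
  · subst hij; rw [hw0, zero_mul, zero_mul]
  · rw [spinDot_one_apply_revCfg hij]

/-- Assembly of the two halves: if `X` commutes with `P` and with `F` then with `P * F`. [folklore] -/
theorem commute_mul_of_commute {ι : Type*} [Fintype ι] (X P F : Matrix ι ι ℂ) (hP : P * X = X * P) (hF : F * X = X * F) :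
    X * (P * F) = (P * F) * X := by
  rw [← Matrix.mul_assoc, ← hP, Matrix.mul_assoc, ← hF, Matrix.mul_assoc]

end Summit.HubbardSuperconductivity.HubbardLadder.ClusterCut
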